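import Mathlib.Analysis.SpecialFunctions.Trigonometric.Chebyshev.RootsExtrema
import Mathlib.Analysis.SpecialFunctions.Trigonometric.DerivHyp
import Mathlib.Analysis.SpecialFunctions.Log.Deriv
import Mathlib.Analysis.Calculus.Deriv.Polynomial
import Mathlib.Analysis.Complex.ExponentialBounds

/-!
# T⁴ programme, spine estimate NE9 — THE RATE AT THE APEX: THE LOGARITHM IN THE CUMULANT-GENERATING-FUNCTION CURRENCY (positivity does not rescue a
# constant factor; Müntz–Chebyshev witness) — census item C46 (b) of cell `pub-balaban-gaps`, seat ne9 (gen 15)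

Cell `pub-balaban-gaps` (YM blitz G2, seat ne9, unit `pub-balaban-gaps-ne9-g15`; record `run/shared/lean/pub/pub-balaban-gaps/ne/NE9.md` §5 row C46).  Sequel to
`DirectPairingApexAnalyticSharp` (C46 (a): in the MODEL currency of `DirectPairingApexAnalytic.norm_deriv_le_log` — holomorphy near the segment, a bound `M`
off it, a bound `η` on it — the apex logarithm is NECESSARY, Chebyshev witness).  The SCHEME (`DirectPairingApexAnalyticScheme.expectAt_rate_of_king_analytic`)
applies that MODEL theorem to a proper sub-class: differences `D = cgf′ − cgf` of CUMULANT GENERATING FUNCTIONS of observables bounded by `1`, which carry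
POSITIVITY (each `e^{cgf}` is a Laplace transform of a probability law).  QUESTION (C46 (b)): does positivity remove the logarithm — is there a constant `C` with
`∣mean′ − mean∣ ≤ C·sup_{∣t∣≤l}∣cgf′ − cgf∣∕l` for all pairs of laws on `[−1, 1]`?  ANSWER (this file): NO.  For every odd `N` and every small `η` there are two
laws `p, p′` on the `N + 1` nodes `x_k = k∕N − 1∕2 ∈ [−1∕2, 1∕2]` with `sup_{∣t∣≤l}∣cgf_{p′} − cgf_p∣ ≤ 6η` and `∣mean_{p′} − mean_p∣ = η∕(e^{l∕N} − 1) ≥ N·η∕(3l)`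
(`DirectPairingApexCGFSharpLaws.cgf_log_loss_witness` ∕ `no_constant_lossFactor_cgf`, the sequel file).  This file: the construction — the
Müntz–Chebyshev exponential sum `P(t) = e^{−t∕2}·T_N((e^{t∕N} − 1)∕h)`, `h = e^{l∕N} − 1`: an exponential sum `Σ_k a_k e^{t·x_k}` on the nodes (`a_k` = the
coefficients of `T_N((u − 1)∕h)` in `u`), `∣P∣ ≤ e^{l∕2}` on `[−l, l]` (the argument of `T_N` stays in `[−1, 1]`), `P(0) = T_N(0) = 0` (so `Σ a_k = 0`),
`P′(0) = sin(Nπ∕2)∕h` (so `Σ a_k x_k = ±1∕h`), `∣a_k∣ ≤ (4∕h + 1)^N` (Chebyshev recursion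
on the coefficients); `p = ` uniform, `p′ = p + η·a` is a probability law while `2η(N+1)(4∕h+1)^N ≤ 1`, and `cgf_{p′} − cgf_p = log(1 + ηP∕M_p)` with `M_p ≥ e^{−l∕2}`.
QUANTITATIVELY the admissibility threshold `η ≤ (2(N+1)(4∕h+1)^N)⁻¹ ≍ e^{−N log(4N∕l)}` means `N ≍ log η⁻¹∕log log η⁻¹`: in the CGF currency the logarithm of
C45 (c) is necessary UP TO A `log log` — positivity can gain at most that (whether it does is not settled here).
* §1 coefficients: `coeff_X_sub_C_mul_le`, `cheb_comp_coeff_le` (`∣coeff_k T_n((X−1)∕h)∣ ≤ (4∕h+1)^n`, `Nat.twoStepInduction` on `T_{n+2} = 2X·T_{n+1} − T_n`),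
  `cheb_comp_natDegree_le`.
* §2 the profile: `abs_profile_le_one` (`∣(e^{t∕N} − 1)∕h∣ ≤ 1` on `∣t∣ ≤ l`), `abs_cheb_comp_exp_le_one`, `cheb_comp_eval_one` (`= T_N(0) = 0`, `N` odd),
  `cheb_comp_derivative_eval_one` (`= N·sin(Nπ∕2)∕h`), `muntz_hasDerivAt_zero` (`P′(0) = sin(Nπ∕2)∕h`), `muntz_eq_sum` (`P(t) = Σ_k a_k e^{t x_k}`),
  `sum_coeff_eq_zero` (`Σ a_k = 0`), `abs_sum_coeff_mul_node` (`∣Σ a_k x_k∣ = 1∕h`).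
* §3 (the laws `p, p′` and the verdicts `cgf_log_loss_witness` ∕ `no_constant_lossFactor_cgf`) is the sequel file `DirectPairingApexCGFSharpLaws` (size split).

HONEST FRAMING: MODEL-level real analysis on hypothesis SHAPES (label MODEL) for rung (B)+1 bookkeeping on ONE FIXED finite four-torus; NO definition; the laws
`p, p′` are finitely supported laws of a `[−1∕2, 1∕2]`-valued observable written as explicit finite sums (no TorusScheme is constructed — whether a Gibbs
realisation on the gauge configuration space exists is not addressed); no statement about Bałaban's d = 4 procedure is made here; NOTHING new is owed by the
E-side; CLASSIFICATION OF NE9 UNCHANGED: WORK-bound (W1 = the one-step renormalization transformation as a Lean object; instance 0∕1); NE9 NOT PRINTED ∕ NOT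
PROVED; spine PROVED 0∕9 unchanged; NOT UV stability, NOT the continuum limit, NOT infinite volume, NOT a mass gap, NOT Clay.

References (TYPES only): Chebyshev polynomials in an exponential (Müntz) variable are the classical extremisers of Markov–Newman-type inequalities for
exponential sums (e.g. P. Borwein–T. Erdélyi, *Polynomials and Polynomial Inequalities*, Springer GTM 161 (1995), §6.1 Newman's inequality) — no statement of
theirs is asserted; Mathlib's `Polynomial.Chebyshev.T_add_two`, `T_real_cos`, `U_real_cos`, `T_derivative_eq_U`, `abs_eval_T_real_le_one`, `natDegree_T`,
`Polynomial.hasDerivAt`, `Polynomial.eval_eq_sum_range'`, `Real.abs_log_sub_add_sum_range_le` consumed BY NAME.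
-/

namespace Summit.QuantumFields.BalabanUV.T4Continuum.NE9.DirectPairingApexCGFSharp

open Real Set Filter Topology Finset Polynomial Polynomial.Chebyshev

/-! ## §1 Coefficients of `T_n((X − 1)∕h)` -/

section Coeff

variable {h : ℝ}

/-- Coefficients of `(X − C 1)·P`: `coeff₀ = −P₀`, `coeff_{k+1} = P_k − P_{k+1}`; hence `∣coeff_k((X − 1)P)∣ ≤ 2B` when `∣P_j∣ ≤ B` for all `j`. [folklore] -/
theorem coeff_X_sub_C_mul_le {P : ℝ[X]} {B : ℝ} (hB : ∀ j, |P.coeff j| ≤ B) (k : ℕ) :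
    |((X - C 1) * P).coeff k| ≤ 2 * B := by
  rw [sub_mul, C_1, one_mul, coeff_sub]
  rcases k with _ | k
  · rw [coeff_X_mul_zero, zero_sub, abs_neg]
    linarith [hB 0, abs_nonneg (P.coeff 0)]
  · rw [coeff_X_mul]
    calc |P.coeff k - P.coeff (k + 1)| ≤ |P.coeff k| + |P.coeff (k + 1)| := abs_sub _ _
      _ ≤ 2 * B := by linarith [hB k, hB (k + 1)]

/-- **THE CHEBYSHEV RECURSION ON THE COEFFICIENTS**: for `0 < h` and every `n k`, `∣coeff_k (T_n ∘ ((X − 1)∕h))∣ ≤ (4∕h + 1)^n`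
(`T_{n+2} = 2X·T_{n+1} − T_n`, so `R_{n+2} = (2∕h)(X − 1)R_{n+1} − R_n` and the sup of the coefficients obeys `m_{n+2} ≤ (4∕h)m_{n+1} + m_n`). [folklore] -/
theorem cheb_comp_coeff_le (hh : 0 < h) (n k : ℕ) :
    |((T ℝ n).comp (C h⁻¹ * (X - C 1))).coeff k| ≤ (4 / h + 1) ^ n := by
  set q : ℝ[X] := C h⁻¹ * (X - C 1) with hq
  have hb : 0 ≤ 4 / h + 1 := by positivity
  induction n using Nat.twoStepInduction generalizing k with
  | zero =>
    simp only [Nat.cast_zero, T_zero, one_comp, pow_zero, coeff_one]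
    split_ifs <;> simp
  | one =>
    simp only [Nat.cast_one, T_one, X_comp, pow_one]
    rw [hq, coeff_C_mul, abs_mul, abs_of_pos (inv_pos.mpr hh)]
    have h1 : |((X - C (1 : ℝ)) * 1).coeff k| ≤ 2 * 1 :=
      coeff_X_sub_C_mul_le (P := 1) (B := 1) (fun j => by rw [coeff_one]; split_ifs <;> simp) k
    rw [mul_one, mul_one] at h1
    have h2 : 2 / h ≤ 4 / h := div_le_div_of_nonneg_right (by norm_num) hh.le
    calc h⁻¹ * |(X - C (1 : ℝ)).coeff k| ≤ h⁻¹ * 2 := mul_le_mul_of_nonneg_left h1 (inv_pos.mpr hh).le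
      _ = 2 / h := by rw [inv_mul_eq_div]
      _ ≤ 4 / h + 1 := by linarith
  | more n ih0 ih1 =>
    have hrec : (T ℝ ((n + 2 : ℕ) : ℤ)).comp q = 2 * q * (T ℝ ((n + 1 : ℕ) : ℤ)).comp q - (T ℝ (n : ℤ)).comp q := by
      have e : ((n + 2 : ℕ) : ℤ) = (n : ℤ) + 2 := by push_cast; ring
      have e1 : ((n + 1 : ℕ) : ℤ) = (n : ℤ) + 1 := by push_cast; ring
      rw [e, e1, T_add_two]
      simp only [sub_comp, mul_comp, X_comp, ofNat_comp, Nat.cast_ofNat]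
    rw [hrec, coeff_sub]
    have hqmul : ∀ j, |(2 * q * (T ℝ ((n + 1 : ℕ) : ℤ)).comp q).coeff j| ≤ 4 / h * (4 / h + 1) ^ (n + 1) := by
      intro j
      have e2 : 2 * q * (T ℝ ((n + 1 : ℕ) : ℤ)).comp q = C (2 * h⁻¹) * ((X - C 1) * (T ℝ ((n + 1 : ℕ) : ℤ)).comp q) := by
        rw [hq, Polynomial.C_mul, map_ofNat]
        ring
      rw [e2, coeff_C_mul, abs_mul, abs_of_pos (by positivity : (0 : ℝ) < 2 * h⁻¹)]
      have h3 := coeff_X_sub_C_mul_le (P := (T ℝ ((n + 1 : ℕ) : ℤ)).comp q) (B := (4 / h + 1) ^ (n + 1)) ih1 j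
      calc 2 * h⁻¹ * |((X - C 1) * (T ℝ ((n + 1 : ℕ) : ℤ)).comp q).coeff j| ≤ 2 * h⁻¹ * (2 * (4 / h + 1) ^ (n + 1)) :=
            mul_le_mul_of_nonneg_left h3 (by positivity)
        _ = 4 / h * (4 / h + 1) ^ (n + 1) := by rw [div_eq_mul_inv]; ring
    calc |(2 * q * (T ℝ ((n + 1 : ℕ) : ℤ)).comp q).coeff k - ((T ℝ (n : ℤ)).comp q).coeff k|
        ≤ |(2 * q * (T ℝ ((n + 1 : ℕ) : ℤ)).comp q).coeff k| + |((T ℝ (n : ℤ)).comp q).coeff k| := abs_sub _ _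
      _ ≤ 4 / h * (4 / h + 1) ^ (n + 1) + (4 / h + 1) ^ n := add_le_add (hqmul k) (ih0 k)
      _ ≤ 4 / h * (4 / h + 1) ^ (n + 1) + (4 / h + 1) ^ (n + 1) := by
          have : (4 / h + 1) ^ n ≤ (4 / h + 1) ^ (n + 1) := pow_le_pow_right₀ (by linarith [div_pos four_pos hh]) (Nat.le_succ n)
          linarith
      _ = (4 / h + 1) ^ (n + 2) := by ring

/-- `natDegree (T_N ∘ ((X − 1)∕h)) ≤ N`. [folklore] -/
theorem cheb_comp_natDegree_le (h : ℝ) (N : ℕ) : ((T ℝ N).comp (C h⁻¹ * (X - C 1))).natDegree ≤ N := by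
  refine (natDegree_comp_le).trans ?_
  rw [natDegree_T, Int.natAbs_natCast]
  have h1 : (C h⁻¹ * (X - C (1 : ℝ))).natDegree ≤ 1 :=
    (natDegree_C_mul_le _ _).trans (by rw [natDegree_X_sub_C])
  calc N * (C h⁻¹ * (X - C (1 : ℝ))).natDegree ≤ N * 1 := Nat.mul_le_mul_left N h1
    _ = N := mul_one N

end Coeff

/-! ## §2 The Müntz–Chebyshev exponential sum `P(t) = e^{−t∕2}·T_N((e^{t∕N} − 1)∕h)`, `h = e^{l∕N} − 1` -/

section Profile

variable {l : ℝ} {N : ℕ}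

/-- `h = e^{l∕N} − 1 > 0` for `0 < l`, `0 < N`. [folklore] -/
theorem expm1_pos (hl : 0 < l) (hN : 0 < N) : 0 < Real.exp (l / N) - 1 := by
  have : 0 < l / N := div_pos hl (Nat.cast_pos.mpr hN)
  linarith [Real.add_one_lt_exp this.ne']

/-- **THE ARGUMENT OF `T_N` STAYS IN `[−1, 1]`**: for `∣t∣ ≤ l` (`0 < l`, `0 < N`), `∣(e^{t∕N} − 1)∕(e^{l∕N} − 1)∣ ≤ 1`
(upper: monotonicity; lower: `1 − e^{−s} ≤ e^{s} − 1`). [folklore] -/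
theorem abs_profile_le_one (hl : 0 < l) (hN : 0 < N) {t : ℝ} (ht : |t| ≤ l) :
    |(Real.exp (t / N) - 1) / (Real.exp (l / N) - 1)| ≤ 1 := by
  have hh := expm1_pos hl hN
  have hNpos : (0 : ℝ) < N := Nat.cast_pos.mpr hN
  rw [abs_div, abs_of_pos hh, div_le_one hh, abs_le]
  obtain ⟨ht1, ht2⟩ := abs_le.mp ht
  constructor
  · -- `−(e^{l∕N} − 1) ≤ e^{t∕N} − 1`: `e^{t∕N} ≥ e^{−l∕N}` and `e^{l∕N} + e^{−l∕N} ≥ 2`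
    have h0 : -l / N ≤ t / N := div_le_div_of_nonneg_right ht1 hNpos.le
    have h1 : Real.exp (-l / N) ≤ Real.exp (t / N) := Real.exp_le_exp.mpr h0
    have hprod : Real.exp (l / N) * Real.exp (-l / N) = 1 := by
      rw [← Real.exp_add, neg_div, add_neg_cancel, Real.exp_zero]
    have h2 : 2 ≤ Real.exp (l / N) + Real.exp (-l / N) := by
      nlinarith [sq_nonneg (Real.exp (l / N) - Real.exp (-l / N)), Real.exp_pos (l / N), Real.exp_pos (-l / N)]
    linarith
  · linarith [Real.exp_le_exp.mpr (div_le_div_of_nonneg_right ht2 hNpos.le)]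

/-- `∣T_N((e^{t∕N} − 1)∕h)∣ ≤ 1` on `∣t∣ ≤ l`, i.e. `∣(T_N ∘ ((X−1)∕h)).eval(e^{t∕N})∣ ≤ 1` (Mathlib's `abs_eval_T_real_le_one`). [folklore] -/
theorem abs_cheb_comp_exp_le_one (hl : 0 < l) (hN : 0 < N) {t : ℝ} (ht : |t| ≤ l) :
    |((T ℝ N).comp (C (Real.exp (l / N) - 1)⁻¹ * (X - C 1))).eval (Real.exp (t / N))| ≤ 1 := by
  rw [eval_comp, eval_mul, eval_C, eval_sub, eval_X, eval_C, ← div_eq_inv_mul]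
  exact abs_eval_T_real_le_one _ (abs_profile_le_one hl hN ht)

/-- `T_N(0) = 0` for odd `N` (`T_N(cos(π∕2)) = cos(Nπ∕2) = cos(mπ + π∕2) = −sin(mπ) = 0`). [folklore] -/
theorem eval_T_zero_of_odd (hN : Odd N) : (T ℝ N).eval 0 = 0 := by
  obtain ⟨m, rfl⟩ := hN
  have h := T_real_cos (π / 2) ((2 * m + 1 : ℕ) : ℤ)
  rw [Real.cos_pi_div_two] at h
  rw [h]
  have e : (((2 * m + 1 : ℕ) : ℤ) : ℝ) * (π / 2) = (m : ℝ) * π + π / 2 := by push_cast; ring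
  rw [e, Real.cos_add_pi_div_two, Real.sin_nat_mul_pi, neg_zero]

/-- `∣sin(Nπ∕2)∣ = 1` for odd `N`. [folklore] -/
theorem abs_sin_odd_mul_pi_div_two (hN : Odd N) : |Real.sin (N * (π / 2))| = 1 := by
  obtain ⟨m, rfl⟩ := hN
  have e : ((2 * m + 1 : ℕ) : ℝ) * (π / 2) = (m : ℝ) * π + π / 2 := by push_cast; ring
  rw [e, Real.sin_add_pi_div_two]
  exact_mod_cast Real.abs_cos_int_mul_pi (m : ℤ)

/-- `(T_N ∘ ((X−1)∕h)).eval 1 = T_N(0) = 0` for odd `N`. [folklore] -/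
theorem cheb_comp_eval_one (h : ℝ) (hN : Odd N) : ((T ℝ N).comp (C h⁻¹ * (X - C 1))).eval 1 = 0 := by
  rw [eval_comp, eval_mul, eval_C, eval_sub, eval_X, eval_C, sub_self, mul_zero, eval_T_zero_of_odd hN]

/-- `T_N′(0) = N·sin(Nπ∕2)` (`T_N′ = N·U_{N−1}`, `U_{N−1}(cos(π∕2))·sin(π∕2) = sin(Nπ∕2)`). [folklore] -/
theorem eval_derivative_T_zero (N : ℕ) : (derivative (T ℝ N)).eval 0 = N * Real.sin (N * (π / 2)) := by
  have hU := U_real_cos (π / 2) ((N : ℤ) - 1)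
  rw [Real.cos_pi_div_two, Real.sin_pi_div_two, mul_one] at hU
  rw [T_derivative_eq_U, eval_mul, eval_intCast, hU]
  push_cast
  ring_nf

/-- The derivative of the composed polynomial at `u = 1`: `(T_N ∘ ((X−1)∕h))′(1) = h⁻¹·N·sin(Nπ∕2)`. [folklore] -/
theorem cheb_comp_derivative_eval_one (h : ℝ) (N : ℕ) :
    (derivative ((T ℝ N).comp (C h⁻¹ * (X - C 1)))).eval 1 = h⁻¹ * (N * Real.sin (N * (π / 2))) := by
  rw [derivative_comp, eval_mul, eval_comp, eval_mul, eval_C, eval_sub, eval_X, eval_C, sub_self, mul_zero,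
    eval_derivative_T_zero]
  congr 1
  rw [derivative_C_mul, derivative_sub, derivative_X, derivative_C, sub_zero, eval_mul, eval_C, eval_one, mul_one]

/-- **`P′(0) = sin(Nπ∕2)∕h`** for the Müntz–Chebyshev sum `P(t) = e^{−t∕2}·(T_N ∘ ((X−1)∕h)).eval(e^{t∕N})`, `N` odd, `h = e^{l∕N} − 1`
(product and chain rules; the `e^{−t∕2}` term does not contribute since `T_N(0) = 0`). [folklore] -/
theorem muntz_hasDerivAt_zero (hN : Odd N) (h : ℝ) :
    HasDerivAt (fun t : ℝ => Real.exp (-(t / 2)) * ((T ℝ N).comp (C h⁻¹ * (X - C 1))).eval (Real.exp (t / N)))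
      (h⁻¹ * Real.sin (N * (π / 2))) 0 := by
  have hNpos : 0 < N := hN.pos
  have hN0 : (N : ℝ) ≠ 0 := (Nat.cast_pos.mpr hNpos).ne'
  set R : ℝ[X] := (T ℝ N).comp (C h⁻¹ * (X - C 1)) with hR
  -- inner map `t ↦ e^{t∕N}`, then the polynomial, then the factor `e^{−t∕2}`
  have hp : HasDerivAt (fun t : ℝ => R.eval (Real.exp (t / N))) ((derivative R).eval 1 * (1 / N)) 0 := by
    have := (R.hasDerivAt (Real.exp (0 / N))).comp 0 (((hasDerivAt_id (0 : ℝ)).div_const (N : ℝ)).exp)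
    simp only [Function.comp_def, id_eq, zero_div, Real.exp_zero, one_mul] at this
    exact this
  have he : HasDerivAt (fun t : ℝ => Real.exp (-(t / 2))) (Real.exp (-(0 / 2)) * (-(1 / 2))) 0 :=
    (((hasDerivAt_id (0 : ℝ)).div_const (2 : ℝ)).fun_neg).exp
  rw [zero_div, neg_zero, Real.exp_zero, one_mul] at he
  have hprod := he.fun_mul hp
  have hval : -(1 / 2) * R.eval (Real.exp (0 / N)) + Real.exp (-(0 / 2)) * ((derivative R).eval 1 * (1 / N)) =
      h⁻¹ * Real.sin (N * (π / 2)) := by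
    rw [zero_div, zero_div, neg_zero, Real.exp_zero, one_mul, hR, cheb_comp_eval_one h hN, mul_zero, zero_add,
      cheb_comp_derivative_eval_one]
    field_simp
  rw [hval] at hprod
  exact hprod

/-- **THE MÜNTZ–CHEBYSHEV SUM IS AN EXPONENTIAL SUM ON THE NODES `x_k = k∕N − 1∕2`**: for every `t`,
`e^{−t∕2}·(T_N ∘ ((X−1)∕h)).eval(e^{t∕N}) = Σ_{k ≤ N} a_k·e^{t(k∕N − 1∕2)}` with `a_k = coeff_k(T_N ∘ ((X−1)∕h))`. [folklore] -/
theorem muntz_eq_sum (hN : 0 < N) (h t : ℝ) :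
    Real.exp (-(t / 2)) * ((T ℝ N).comp (C h⁻¹ * (X - C 1))).eval (Real.exp (t / N)) =
      ∑ k ∈ range (N + 1), ((T ℝ N).comp (C h⁻¹ * (X - C 1))).coeff k * Real.exp (t * ((k : ℝ) / N - 1 / 2)) := by
  rw [eval_eq_sum_range' (Nat.lt_succ_of_le (cheb_comp_natDegree_le h N)), mul_sum]
  refine sum_congr rfl fun k _ => ?_
  rw [← Real.exp_nat_mul, mul_left_comm, ← Real.exp_add]
  congr 2
  have hN0 : (N : ℝ) ≠ 0 := (Nat.cast_pos.mpr hN).ne'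
  field_simp
  ring

/-- The exponential sum has derivative `Σ a_k x_k e^{t x_k}` — at `t = 0`, `Σ a_k x_k`. [folklore] -/
theorem hasDerivAt_expSum_zero (a x : ℕ → ℝ) (n : ℕ) :
    HasDerivAt (fun t : ℝ => ∑ k ∈ range n, a k * Real.exp (t * x k)) (∑ k ∈ range n, a k * x k) 0 := by
  have h : ∀ k ∈ range n, HasDerivAt (fun t : ℝ => a k * Real.exp (t * x k)) (a k * x k) 0 := by
    intro k _
    have h1 : HasDerivAt (fun t : ℝ => Real.exp (t * x k)) (Real.exp (0 * x k) * (1 * x k)) 0 :=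
      ((hasDerivAt_id (0 : ℝ)).mul_const (x k)).exp
    rw [zero_mul, Real.exp_zero, one_mul, one_mul] at h1
    exact h1.const_mul (a k)
  exact HasDerivAt.fun_sum h

/-- **`Σ_k a_k = 0`** (`= P(0) = T_N(0)`, `N` odd). [folklore] -/
theorem sum_coeff_eq_zero (hN : Odd N) (h : ℝ) :
    ∑ k ∈ range (N + 1), ((T ℝ N).comp (C h⁻¹ * (X - C 1))).coeff k = 0 := by
  have h0 := muntz_eq_sum hN.pos h 0
  simp only [zero_div, neg_zero, Real.exp_zero, one_mul, zero_mul, mul_one] at h0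
  rw [← h0, cheb_comp_eval_one h hN]

/-- **`∣Σ_k a_k x_k∣ = 1∕h`** (`= ∣P′(0)∣ = ∣sin(Nπ∕2)∣∕h`, `N` odd, `0 < h`; uniqueness of the derivative). [folklore] -/
theorem abs_sum_coeff_mul_node (hN : Odd N) {h : ℝ} (hh : 0 < h) :
    |∑ k ∈ range (N + 1), ((T ℝ N).comp (C h⁻¹ * (X - C 1))).coeff k * ((k : ℝ) / N - 1 / 2)| = 1 / h := by
  have h1 := muntz_hasDerivAt_zero hN h
  have h2 := hasDerivAt_expSum_zero (fun k => ((T ℝ N).comp (C h⁻¹ * (X - C 1))).coeff k) (fun k => (k : ℝ) / N - 1 / 2) (N + 1)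
  have hfun : (fun t : ℝ => Real.exp (-(t / 2)) * ((T ℝ N).comp (C h⁻¹ * (X - C 1))).eval (Real.exp (t / N))) =
      fun t : ℝ => ∑ k ∈ range (N + 1), ((T ℝ N).comp (C h⁻¹ * (X - C 1))).coeff k * Real.exp (t * ((k : ℝ) / N - 1 / 2)) :=
    funext fun t => muntz_eq_sum hN.pos h t
  rw [hfun] at h1
  rw [h2.unique h1, abs_mul, abs_of_pos (inv_pos.mpr hh), abs_sin_odd_mul_pi_div_two hN, mul_one, one_div]

end Profile

end Summit.QuantumFields.BalabanUV.T4Continuum.NE9.DirectPairingApexCGFSharp
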